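import Summits.ResolutionOfSingularities.ResolutionOfSingularities.Theorems.RadicialJungCleanModelsCcurveRegInside
import Literature.AlgebraicGeometry.Resolution.ValuationOverrings
import HarnessLib

/-!
# Route `RadicialJung`, crux `CleanModels` (stmt-15917) — (C-curve) sub-line, `curveRegularize` (classical route) II: the residue valuation ring of `O` on the
# residue field of the local ring at the centre curve

Lead `res-B-lead-1` g7 (workfile `Lines/Sketch_Ccurve_assembly.lean` v2.9, S3-core `stub_Cc_curveRegularize`; classical, F-32-free route).  OURS · counted 0.
Nothing here proves resolution in characteristic `p`; resolution in char `p` is NOT proved.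

Setting: a local subring `R₁ ⊆ O₁` of `K` whose `O₁`-units are invertible in `R₁` (e.g. `R₁ = locAtCentre B O₁`), and a refinement `O ≤ O₁`.  On the residue field
`L = κ(R₁)` the valuation ring `O` induces a valuation ring `V̄` = {residues of the elements of `R₁ ∩ O`} (`exists_residueValuationSubring`); membership, units and
the order of values in `V̄` are read off `O` on `O₁`-units of `R₁` (`mem_residueVal_iff`, `residueVal_eq_one_iff`, `residueVal_le_iff`), and `V̄ ≠ L` as soon as
`R₁` has an `O₁`-unit which is not an `O`-unit (`residueVal_ne_top`).  No definitions: `V̄` is produced existentially with its two characterising properties.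
-/

noncomputable section

set_option linter.dupNamespace false

open IsLocalRing Literature.AlgebraicGeometry.Resolution
open Summit.ResolutionOfSingularities.ResolutionOfSingularities.Theorems

namespace Summit.ResolutionOfSingularities.ResolutionOfSingularities.Theorems.RadicialJung.CleanModels.Ccurve

/-! ## Generic facts on valuation subrings -/

section generic

variable {L : Type} [Field L] (W : ValuationSubring L)

/-- `W.valuation x = 1` iff `x` and `x⁻¹` lie in `W`, for `x ≠ 0`. [folklore] -/
theorem valuation_eq_one_iff_mem_and_inv_mem {x : L} (hx : x ≠ 0) : W.valuation x = 1 ↔ x ∈ W ∧ x⁻¹ ∈ W := by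
  constructor
  · intro h
    refine ⟨(W.valuation_le_one_iff _).mp h.le, (W.valuation_le_one_iff _).mp ?_⟩
    rw [map_inv₀, h, inv_one]
  · rintro ⟨h1, h2⟩
    apply le_antisymm ((W.valuation_le_one_iff _).mpr h1)
    have h := (W.valuation_le_one_iff _).mpr h2
    rwa [map_inv₀, inv_le_one₀ ((Valuation.pos_iff _).mpr hx)] at h

/-- `W.valuation a ≤ W.valuation b` iff `a / b ∈ W`, for `b ≠ 0`. [folklore] -/
theorem valuation_le_iff_div_mem {a b : L} (hb : b ≠ 0) : W.valuation a ≤ W.valuation b ↔ a / b ∈ W := by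
  rw [← W.valuation_le_one_iff, map_div₀, div_le_one₀ ((Valuation.pos_iff _).mpr hb)]

/-- `W.valuation x < 1` iff `x⁻¹ ∉ W`, for `x ≠ 0`. [folklore] -/
theorem valuation_lt_one_iff_inv_not_mem {x : L} (hx : x ≠ 0) : W.valuation x < 1 ↔ x⁻¹ ∉ W := by
  rw [← W.valuation_le_one_iff, map_inv₀, not_le, one_lt_inv₀ ((Valuation.pos_iff _).mpr hx)]

end generic

variable {K : Type} [Field K]

section residue

variable {R₁ : Subring K} [IsLocalRing ↥R₁] {O O₁ : ValuationSubring K} (hOO₁ : O ≤ O₁) (hR₁O₁ : R₁ ≤ O₁.toSubring)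
  (hinv : ∀ {r : K}, r ∈ R₁ → O₁.valuation r = 1 → r⁻¹ ∈ R₁)

omit [IsLocalRing ↥R₁] in
include hR₁O₁ hinv in
/-- Units of `R₁` are its `O₁`-units. [folklore] -/
theorem isUnit_coarse_iff (r : ↥R₁) : IsUnit r ↔ O₁.valuation (r : K) = 1 := by
  rw [isUnit_subring_iff_inv_mem]
  constructor
  · rintro ⟨hr0, hrinv⟩
    apply le_antisymm ((O₁.valuation_le_one_iff _).mpr (hR₁O₁ r.2))
    have h := (O₁.valuation_le_one_iff _).mpr (hR₁O₁ hrinv)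
    rwa [map_inv₀, inv_le_one₀ ((Valuation.pos_iff _).mpr hr0)] at h
  · intro h
    exact ⟨ne_zero_of_valuation_eq_one h, hinv r.2 h⟩

include hR₁O₁ hinv in
/-- The maximal ideal of `R₁` consists of its `O₁`-non-units. [folklore] -/
theorem mem_maximalIdeal_coarse_iff (r : ↥R₁) : r ∈ maximalIdeal ↥R₁ ↔ O₁.valuation (r : K) < 1 := by
  rw [IsLocalRing.mem_maximalIdeal, mem_nonunits_iff, isUnit_coarse_iff hR₁O₁ hinv]
  constructor
  · intro h; exact lt_of_le_of_ne ((O₁.valuation_le_one_iff _).mpr (hR₁O₁ r.2)) h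
  · intro h; exact h.ne

include hR₁O₁ hinv in
/-- The residue of `r ∈ R₁` vanishes iff `r` is an `O₁`-non-unit. [folklore] -/
theorem residue_eq_zero_iff_coarse (r : ↥R₁) : residue ↥R₁ r = 0 ↔ O₁.valuation (r : K) < 1 := by
  rw [residue_eq_zero_iff, mem_maximalIdeal_coarse_iff hR₁O₁ hinv]

include hR₁O₁ hinv in
/-- The residue of `r ∈ R₁` is nonzero iff `r` is an `O₁`-unit. [folklore] -/
theorem residue_ne_zero_iff_coarse (r : ↥R₁) : residue ↥R₁ r ≠ 0 ↔ O₁.valuation (r : K) = 1 := by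
  rw [Ne, residue_eq_zero_iff_coarse hR₁O₁ hinv, not_lt]
  constructor
  · intro h; exact le_antisymm ((O₁.valuation_le_one_iff _).mpr (hR₁O₁ r.2)) h
  · intro h; exact h.ge

include hinv in
/-- The residue of the inverse of an `O₁`-unit is the inverse of the residue. [folklore] -/
theorem residue_inv_coarse (r : ↥R₁) (hr : O₁.valuation (r : K) = 1) :
    residue ↥R₁ ⟨(r : K)⁻¹, hinv r.2 hr⟩ = (residue ↥R₁ r)⁻¹ := by
  have hr0 : (r : K) ≠ 0 := ne_zero_of_valuation_eq_one hr
  have hmul : residue ↥R₁ r * residue ↥R₁ ⟨(r : K)⁻¹, hinv r.2 hr⟩ = 1 := by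
    rw [← map_mul]
    have : r * ⟨(r : K)⁻¹, hinv r.2 hr⟩ = 1 := Subtype.ext (mul_inv_cancel₀ hr0)
    rw [this, map_one]
  exact (eq_inv_of_mul_eq_one_right hmul)

include hR₁O₁ hinv in
/-- **The residue valuation ring.**  On `L = κ(R₁)` the residues of the elements of `R₁ ∩ O` form a valuation subring `V̄`; it is characterised by: residues of
elements of `R₁ ∩ O` lie in `V̄`, and every element of `V̄` is such a residue. [folklore] -/
theorem exists_residueValuationSubring :
    ∃ V : ValuationSubring (ResidueField ↥R₁),
      (∀ r : ↥R₁, (r : K) ∈ O → residue ↥R₁ r ∈ V) ∧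
      (∀ ξ : ResidueField ↥R₁, ξ ∈ V → ∃ r : ↥R₁, (r : K) ∈ O ∧ residue ↥R₁ r = ξ) := by
  classical
  let W : Subring ↥R₁ := O.toSubring.comap R₁.subtype
  let V₀ : Subring (ResidueField ↥R₁) := W.map (residue ↥R₁)
  have hmem : ∀ ξ : ResidueField ↥R₁, ξ ∈ V₀ ↔ ∃ r : ↥R₁, (r : K) ∈ O ∧ residue ↥R₁ r = ξ := by
    intro ξ
    constructor
    · rintro ⟨r, hr, rfl⟩; exact ⟨r, hr, rfl⟩
    · rintro ⟨r, hr, rfl⟩; exact ⟨r, hr, rfl⟩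
  refine ⟨⟨V₀, fun ξ => ?_⟩, fun r hr => (hmem _).mpr ⟨r, hr, rfl⟩, fun ξ hξ => (hmem ξ).mp hξ⟩
  obtain ⟨r, rfl⟩ := residue_surjective ξ
  by_cases h0 : residue ↥R₁ r = 0
  · left; rw [h0]; exact V₀.zero_mem
  · have hr1 : O₁.valuation (r : K) = 1 := (residue_ne_zero_iff_coarse hR₁O₁ hinv r).mp h0
    rcases O.mem_or_inv_mem (r : K) with h | h
    · left; exact (hmem _).mpr ⟨r, h, rfl⟩
    · right
      refine (hmem _).mpr ⟨⟨(r : K)⁻¹, hinv r.2 hr1⟩, h, ?_⟩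
      exact residue_inv_coarse hinv r hr1

variable (V : ValuationSubring (ResidueField ↥R₁)) (hV₁ : ∀ r : ↥R₁, (r : K) ∈ O → residue ↥R₁ r ∈ V)
  (hV₂ : ∀ ξ : ResidueField ↥R₁, ξ ∈ V → ∃ r : ↥R₁, (r : K) ∈ O ∧ residue ↥R₁ r = ξ)

include hOO₁ hR₁O₁ hinv hV₁ hV₂ in
/-- Membership in `V̄` of the residue of an `O₁`-unit `r` of `R₁` is membership of `r` in `O`. [folklore] -/
theorem mem_residueVal_iff (r : ↥R₁) : residue ↥R₁ r ∈ V ↔ (r : K) ∈ O := by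
  constructor
  · intro h
    obtain ⟨r', hr'O, heq⟩ := hV₂ _ h
    have hdiff : residue ↥R₁ (r - r') = 0 := by rw [map_sub, heq, sub_self]
    have hlt : O₁.valuation ((r - r' : ↥R₁) : K) < 1 := (residue_eq_zero_iff_coarse hR₁O₁ hinv _).mp hdiff
    have hmO : ((r : K) - r') ∈ O := mem_of_valuation_coarse_lt hOO₁ hlt
    have : (r : K) = ((r : K) - r') + r' := by ring
    rw [this]; exact add_mem hmO hr'O
  · exact hV₁ r

include hOO₁ hR₁O₁ hinv hV₁ hV₂ in
/-- For an `O₁`-unit `r ∈ R₁ ∩ O`: its residue is a unit of `V̄` iff `r` is an `O`-unit. [folklore] -/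
theorem residueVal_eq_one_iff (r : ↥R₁) (hr : O₁.valuation (r : K) = 1) :
    V.valuation (residue ↥R₁ r) = 1 ↔ O.valuation (r : K) = 1 := by
  have hres0 : residue ↥R₁ r ≠ 0 := (residue_ne_zero_iff_coarse hR₁O₁ hinv r).mpr hr
  have hr0 : (r : K) ≠ 0 := ne_zero_of_valuation_eq_one hr
  rw [valuation_eq_one_iff_mem_and_inv_mem V hres0, valuation_eq_one_iff_mem_and_inv_mem O hr0,
    mem_residueVal_iff hOO₁ hR₁O₁ hinv V hV₁ hV₂ r, ← residue_inv_coarse hinv r hr,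
    mem_residueVal_iff hOO₁ hR₁O₁ hinv V hV₁ hV₂]

include hOO₁ hR₁O₁ hinv hV₁ hV₂ in
/-- For an `O₁`-unit `r ∈ R₁`: `V̄.valuation (res r) < 1` iff `O.valuation r < 1`. [folklore] -/
theorem residueVal_lt_one_iff (r : ↥R₁) (hr : O₁.valuation (r : K) = 1) :
    V.valuation (residue ↥R₁ r) < 1 ↔ O.valuation (r : K) < 1 := by
  have hres0 : residue ↥R₁ r ≠ 0 := (residue_ne_zero_iff_coarse hR₁O₁ hinv r).mpr hr
  have hr0 : (r : K) ≠ 0 := ne_zero_of_valuation_eq_one hr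
  rw [valuation_lt_one_iff_inv_not_mem V hres0, valuation_lt_one_iff_inv_not_mem O hr0, ← residue_inv_coarse hinv r hr,
    mem_residueVal_iff hOO₁ hR₁O₁ hinv V hV₁ hV₂]

include hOO₁ hR₁O₁ hinv hV₁ hV₂ in
/-- Order of values in `V̄` vs `O`: for `a ∈ R₁` and an `O₁`-unit `b ∈ R₁`, `V̄.val (res a) ≤ V̄.val (res b)` iff `O.val a ≤ O.val b`. [folklore] -/
theorem residueVal_le_iff (a b : ↥R₁) (hb : O₁.valuation (b : K) = 1) :
    V.valuation (residue ↥R₁ a) ≤ V.valuation (residue ↥R₁ b) ↔ O.valuation (a : K) ≤ O.valuation (b : K) := by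
  have hres0 : residue ↥R₁ b ≠ 0 := (residue_ne_zero_iff_coarse hR₁O₁ hinv b).mpr hb
  have hb0 : (b : K) ≠ 0 := ne_zero_of_valuation_eq_one hb
  rw [valuation_le_iff_div_mem V hres0, valuation_le_iff_div_mem O hb0]
  have hq : residue ↥R₁ a / residue ↥R₁ b = residue ↥R₁ (a * ⟨(b : K)⁻¹, hinv b.2 hb⟩) := by
    rw [map_mul, residue_inv_coarse hinv b hb, div_eq_mul_inv]
  rw [hq]
  by_cases ha0 : residue ↥R₁ a = 0
  · -- `a` is an `O₁`-non-unit: both sides hold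
    have hva : O₁.valuation (a : K) < 1 := (residue_eq_zero_iff_coarse hR₁O₁ hinv a).mp ha0
    have hlhs : residue ↥R₁ (a * ⟨(b : K)⁻¹, hinv b.2 hb⟩) ∈ V := by
      rw [map_mul, ha0, zero_mul]; exact V.zero_mem
    have hrhs : (a : K) / b ∈ O := by
      apply mem_of_valuation_coarse_lt hOO₁
      rw [map_div₀, hb, div_one]; exact hva
    exact ⟨fun _ => hrhs, fun _ => hlhs⟩
  · have ha1 : O₁.valuation (a : K) = 1 := (residue_ne_zero_iff_coarse hR₁O₁ hinv a).mp ha0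
    have hab : O₁.valuation ((a * ⟨(b : K)⁻¹, hinv b.2 hb⟩ : ↥R₁) : K) = 1 := by
      change O₁.valuation ((a : K) * (b : K)⁻¹) = 1
      rw [map_mul, map_inv₀, ha1, hb, inv_one, mul_one]
    rw [mem_residueVal_iff hOO₁ hR₁O₁ hinv V hV₁ hV₂ (a * ⟨(b : K)⁻¹, hinv b.2 hb⟩)]
    change (a : K) * (b : K)⁻¹ ∈ O ↔ (a : K) / b ∈ O
    rw [div_eq_mul_inv]

include hOO₁ hR₁O₁ hinv hV₁ hV₂ in
/-- `V̄ ≠ L` as soon as `R₁` contains an `O₁`-unit `x` which is an `O`-non-unit (its inverse has residue outside `V̄`). [folklore] -/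
theorem residueVal_ne_top {x : K} (hx : x ∈ R₁) (hvx : O.valuation x < 1) (hvx₁ : O₁.valuation x = 1) : V ≠ ⊤ := by
  intro htop
  have hxinv : x⁻¹ ∈ R₁ := hinv hx hvx₁
  have hv : O₁.valuation ((⟨x⁻¹, hxinv⟩ : ↥R₁) : K) = 1 := by
    change O₁.valuation x⁻¹ = 1; rw [map_inv₀, hvx₁, inv_one]
  have hmem : residue ↥R₁ ⟨x⁻¹, hxinv⟩ ∈ V := by rw [htop]; exact Subring.mem_top _
  have hxO : x⁻¹ ∈ O := (mem_residueVal_iff hOO₁ hR₁O₁ hinv V hV₁ hV₂ ⟨x⁻¹, hxinv⟩).mp hmem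
  have h1 : O.valuation x⁻¹ ≤ 1 := (O.valuation_le_one_iff _).mpr hxO
  have hx0 : x ≠ 0 := ne_zero_of_valuation_eq_one hvx₁
  rw [map_inv₀, inv_le_one₀ ((Valuation.pos_iff _).mpr hx0)] at h1
  exact not_le.mpr hvx h1

end residue

end Summit.ResolutionOfSingularities.ResolutionOfSingularities.Theorems.RadicialJung.CleanModels.Ccurve

end
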